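import Summits.AtomisticToContinuum.Crystallization.Theorems.PricedLinkCensusStackingHingeLjDominationDual

/-!
# `PricedLinkCensus.StackingHinge` (stmt-AtomisticToContinuum-14993), line `Sketch`, stub `stub_ljDomination`,
# helper 2: certified exponential decay of the registry coupling and the certified size of `J₂`

With `G = θ¹_0 - θ¹_1` the unit-spacing aligned-minus-offset Gaussian layer sum, `τ = 87/20` and
`D_a(H) = barlowCoupling lennardJones a H 1`:

* `ljd_negD_le`, `ljd_scale`: `-D_a(H) ≤ (1/12) a⁻⁶ ∫_0^∞ G(u) u² e^{-u (H/a)²} du` (Bernstein representation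
  `LayeredHull.reg_barlowCoupling_eq_integral`, `-w(t) ≤ t²/12`, scaling `u = a² t`);
* `ljd_F_le`: `∫_0^∞ G(u) u² e^{-su} du ≤ 19 τ² e^{-2μ} + τ² e^{-τ s}/(s₃ - 2/τ)` whenever `s ≥ s₃ = (117/50)²` and
  `μ² ≤ 13.159 s` (on `(0, τ]`: `G(u) ≤ (38/u) e^{-13.159/u}` from helper 1 and `13.159/u + s u ≥ 2μ`; on `[τ, ∞)`:
  `G ≤ 1`, `LayeredHull.reg_G_le_one`);
* `ljd_Fk_le`: hence `∫_0^∞ G(u) u² e^{-u (k c)²} du ≤ C_F ρ^k` for `k ≥ 3`, `c ≥ 39/50`, with `ρ = 9/2500 ≥ e^{-5.658}`;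
* `stub_ljdJ2Lower` (registrable form): `-D_a(17a/10) ≥ (1797/10⁷)/(12 a⁶)` for `a ≥ 47/50` (the one-point
  certificate `LayeredHull.reg_certificate` with `m = 1` at `s = (17/10)²`, scaled by
  `LayeredHull.reg_scaled_certificate`).
-/

noncomputable section

namespace Summit.AtomisticToContinuum.Crystallization.Theorems.PricedHcpWindowsLjDomination

open MeasureTheory Set Real Filter Module
open scoped BigOperators Nat
open Literature.MathematicalPhysics.StatisticalMechanics Literature.Algebra.EuclideanLattices
open Summit.AtomisticToContinuum.Crystallization.Theorems.LayeredHull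

/-! ## `-D_a(H)` is dominated by the `t²`-moment of the Gaussian layer sum -/

/-- `-D_a(H) ≤ (1/12) ∫_0^∞ g_a(t) t² e^{-tH²} dt` (`w(t) = t⁵/1440 - t²/12 ≥ -t²/12`, `g_a ≥ 0`). [folklore] -/
theorem ljd_negD_le {a H : ℝ} (ha : 0 < a) (hH : H ≠ 0) :
    -barlowCoupling lennardJones a H 1 ≤
      1 / 12 * ∫ t in Ioi (0 : ℝ), (layerInteraction (fun r => Real.exp (-t * r ^ 2)) a 0 0 0 -
        layerInteraction (fun r => Real.exp (-t * r ^ 2)) a 0 1 0) * t ^ 2 * Real.exp (-(t * H ^ 2)) := by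
  have hH2 : 0 < H ^ 2 := by positivity
  have hint : IntegrableOn (fun t => (layerInteraction (fun r => Real.exp (-t * r ^ 2)) a 0 0 0 -
      layerInteraction (fun r => Real.exp (-t * r ^ 2)) a 0 1 0) * lennardJonesDensity t * Real.exp (-(t * H ^ 2)))
      (Ioi 0) := by
    refine IntegrableOn.congr_fun (reg_integrableOn_diff_poly ha.ne' hH2 (-(1 / 12)) 0 (1 / 1440) 0)
      (fun t _ => ?_) measurableSet_Ioi
    simp only [lennardJonesDensity]
    ring
  have hint2 : IntegrableOn (fun t => 1 / 12 * ((layerInteraction (fun r => Real.exp (-t * r ^ 2)) a 0 0 0 -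
      layerInteraction (fun r => Real.exp (-t * r ^ 2)) a 0 1 0) * t ^ 2 * Real.exp (-(t * H ^ 2)))) (Ioi 0) := by
    refine IntegrableOn.congr_fun (reg_integrableOn_diff_poly ha.ne' hH2 (1 / 12) 0 0 0)
      (fun t _ => ?_) measurableSet_Ioi
    ring
  rw [reg_barlowCoupling_eq_integral ha hH, ← integral_neg, ← integral_const_mul]
  refine setIntegral_mono_on hint.neg hint2 measurableSet_Ioi fun t (ht : 0 < t) => ?_
  have hg0 : 0 ≤ layerInteraction (fun r => Real.exp (-t * r ^ 2)) a 0 0 0 -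
      layerInteraction (fun r => Real.exp (-t * r ^ 2)) a 0 1 0 :=
    sub_nonneg.2 (reg_theta_le_theta_zero ha.ne' 1 ht)
  have hw : -lennardJonesDensity t ≤ 1 / 12 * t ^ 2 := by
    simp only [lennardJonesDensity]
    nlinarith [pow_pos ht 5]
  have he : 0 ≤ Real.exp (-(t * H ^ 2)) := (Real.exp_pos _).le
  calc -((layerInteraction (fun r => Real.exp (-t * r ^ 2)) a 0 0 0 -
        layerInteraction (fun r => Real.exp (-t * r ^ 2)) a 0 1 0) * lennardJonesDensity t * Real.exp (-(t * H ^ 2)))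
      = (layerInteraction (fun r => Real.exp (-t * r ^ 2)) a 0 0 0 -
          layerInteraction (fun r => Real.exp (-t * r ^ 2)) a 0 1 0) * Real.exp (-(t * H ^ 2)) *
          (-lennardJonesDensity t) := by ring
    _ ≤ (layerInteraction (fun r => Real.exp (-t * r ^ 2)) a 0 0 0 -
          layerInteraction (fun r => Real.exp (-t * r ^ 2)) a 0 1 0) * Real.exp (-(t * H ^ 2)) *
          (1 / 12 * t ^ 2) := mul_le_mul_of_nonneg_left hw (mul_nonneg hg0 he)
    _ = _ := by ring

/-- Scaling `u = a² t`: `∫_0^∞ g_a(t) t² e^{-tH²} dt = a⁻⁶ ∫_0^∞ G(u) u² e^{-u (H/a)²} du` for `a > 0`. [folklore] -/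
theorem ljd_scale {a : ℝ} (ha : 0 < a) (H : ℝ) :
    ∫ t in Ioi (0 : ℝ), (layerInteraction (fun r => Real.exp (-t * r ^ 2)) a 0 0 0 -
        layerInteraction (fun r => Real.exp (-t * r ^ 2)) a 0 1 0) * t ^ 2 * Real.exp (-(t * H ^ 2)) =
      (a ^ 6)⁻¹ * ∫ u in Ioi (0 : ℝ), (layerInteraction (fun r => Real.exp (-u * r ^ 2)) 1 0 0 0 -
        layerInteraction (fun r => Real.exp (-u * r ^ 2)) 1 0 1 0) * u ^ 2 * Real.exp (-(u * (H / a) ^ 2)) := by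
  set F : ℝ → ℝ := fun u => (layerInteraction (fun r => Real.exp (-u * r ^ 2)) 1 0 0 0 -
    layerInteraction (fun r => Real.exp (-u * r ^ 2)) 1 0 1 0) * u ^ 2 * Real.exp (-(u * (H / a) ^ 2)) with hF
  have h := reg_integral_comp_sq_mul ha F
  have hFt : ∀ t : ℝ, F (a ^ 2 * t) = a ^ 4 * ((layerInteraction (fun r => Real.exp (-t * r ^ 2)) a 0 0 0 -
      layerInteraction (fun r => Real.exp (-t * r ^ 2)) a 0 1 0) * t ^ 2 * Real.exp (-(t * H ^ 2))) := by
    intro t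
    simp only [hF]
    rw [← reg_theta_scale a 0 t, ← reg_theta_scale a 1 t,
      show a ^ 2 * t * (H / a) ^ 2 = t * H ^ 2 by field_simp]
    ring
  rw [setIntegral_congr_fun measurableSet_Ioi (fun t _ => hFt t), integral_const_mul] at h
  have ha4 : (a ^ 4) ≠ 0 := by positivity
  calc (∫ t in Ioi (0 : ℝ), (layerInteraction (fun r => Real.exp (-t * r ^ 2)) a 0 0 0 -
        layerInteraction (fun r => Real.exp (-t * r ^ 2)) a 0 1 0) * t ^ 2 * Real.exp (-(t * H ^ 2)))
      = (a ^ 4)⁻¹ * (a ^ 4 * ∫ t in Ioi (0 : ℝ), (layerInteraction (fun r => Real.exp (-t * r ^ 2)) a 0 0 0 -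
          layerInteraction (fun r => Real.exp (-t * r ^ 2)) a 0 1 0) * t ^ 2 * Real.exp (-(t * H ^ 2))) := by
        rw [← mul_assoc, inv_mul_cancel₀ ha4, one_mul]
    _ = (a ^ 4)⁻¹ * ((a ^ 2)⁻¹ * ∫ u in Ioi (0 : ℝ), F u) := by rw [h]
    _ = (a ^ 6)⁻¹ * ∫ u in Ioi (0 : ℝ), F u := by
        rw [← mul_assoc, ← mul_inv]
        congr 2
        ring

/-! ## The split bound for `F(s) = ∫_0^∞ G(u) u² e^{-su} du` -/

/-- **The `t²`-moment of `G` is exponentially small.** For `s ≥ s₃ = 13689/2500 = (117/50)²` and `μ ≥ 0` with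
`μ² ≤ 13.159 s`:
`∫_0^∞ G(u) u² e^{-su} du ≤ 19 τ² e^{-2μ} + τ² e^{-τ s}/(s₃ - 2/τ)`, `τ = 87/20`
(`(0, τ]`: `G ≤ (38/u) e^{-13.159/u}` and `13.159/u + su ≥ 2μ`, `∫_0^τ u du = τ²/2`; `[τ, ∞)`: `G ≤ 1`,
`u² e^{-su} ≤ τ² e^{-2} e^{-(s - 2/τ)u}`). [folklore] -/
theorem ljd_F_le {s μ : ℝ} (hs : 13689 / 2500 ≤ s) (hμ : μ ^ 2 ≤ 13159 / 1000 * s) :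
    ∫ u in Ioi (0 : ℝ), (layerInteraction (fun r => Real.exp (-u * r ^ 2)) 1 0 0 0 -
        layerInteraction (fun r => Real.exp (-u * r ^ 2)) 1 0 1 0) * u ^ 2 * Real.exp (-(u * s)) ≤
      19 * (87 / 20) ^ 2 * Real.exp (-(2 * μ)) +
        (87 / 20) ^ 2 * Real.exp (-(87 / 20 * s)) / (13689 / 2500 - 2 / (87 / 20)) := by
  set τ : ℝ := 87 / 20 with hτ
  have hτ0 : 0 < τ := by norm_num
  have hs0 : 0 < s := by linarith
  have hc3 : (0 : ℝ) < 13689 / 2500 - 2 / τ := by rw [hτ]; norm_num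
  have hc0 : 0 < s - 2 / τ := by rw [hτ]; linarith
  set F : ℝ → ℝ := fun u => (layerInteraction (fun r => Real.exp (-u * r ^ 2)) 1 0 0 0 -
    layerInteraction (fun r => Real.exp (-u * r ^ 2)) 1 0 1 0) * u ^ 2 * Real.exp (-(u * s)) with hF
  have hFi : IntegrableOn F (Ioi 0) :=
    IntegrableOn.congr_fun (reg_integrableOn_diff_poly one_ne_zero hs0 1 0 0 0)
      (fun u _ => by simp only [hF]; ring) measurableSet_Ioi
  have hsplit : ∫ u in Ioi (0 : ℝ), F u = (∫ u in Ioc 0 τ, F u) + ∫ u in Ioi τ, F u := by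
    rw [← setIntegral_union Set.Ioc_disjoint_Ioi_same measurableSet_Ioi (hFi.mono_set Ioc_subset_Ioi_self)
      (hFi.mono_set (Ioi_subset_Ioi hτ0.le)), Ioc_union_Ioi_eq_Ioi hτ0.le]
  -- Part 1: `(0, τ]`
  have hpt1 : ∀ u ∈ Ioc (0 : ℝ) τ, F u ≤ 38 * Real.exp (-(2 * μ)) * u := by
    rintro u ⟨hu, huτ⟩
    have hG := stub_ljdGaussBound u hu huτ
    have hkey : 0 ≤ (u * s - μ) ^ 2 + (13159 / 1000 * s - μ ^ 2) := add_nonneg (sq_nonneg _) (by linarith)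
    have hamgm : 2 * μ ≤ 13159 / 1000 / u + u * s := by
      rw [div_add' _ _ _ hu.ne', le_div_iff₀ hu]
      nlinarith [hkey, hs0, hu]
    have hnn : 0 ≤ u ^ 2 * Real.exp (-(u * s)) := by positivity
    calc F u = (layerInteraction (fun r => Real.exp (-u * r ^ 2)) 1 0 0 0 -
          layerInteraction (fun r => Real.exp (-u * r ^ 2)) 1 0 1 0) * (u ^ 2 * Real.exp (-(u * s))) := by
          simp only [hF]
          ring
      _ ≤ 38 / u * Real.exp (-(13159 / 1000 / u)) * (u ^ 2 * Real.exp (-(u * s))) :=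
          mul_le_mul_of_nonneg_right hG hnn
      _ = 38 * u * Real.exp (-(13159 / 1000 / u + u * s)) := by
          rw [neg_add, Real.exp_add]
          field_simp
      _ ≤ 38 * u * Real.exp (-(2 * μ)) := by
          refine mul_le_mul_of_nonneg_left (Real.exp_le_exp.2 (neg_le_neg hamgm)) (by positivity)
      _ = 38 * Real.exp (-(2 * μ)) * u := by ring
  have h1a : ∫ u in Ioc 0 τ, F u ≤ ∫ u in Ioc 0 τ, 38 * Real.exp (-(2 * μ)) * u :=
    setIntegral_mono_on (hFi.mono_set Ioc_subset_Ioi_self)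
      ((by fun_prop : Continuous fun u : ℝ => 38 * Real.exp (-(2 * μ)) * u).integrableOn_Icc.mono_set
        Ioc_subset_Icc_self) measurableSet_Ioc hpt1
  have h1b : ∫ u in Ioc 0 τ, 38 * Real.exp (-(2 * μ)) * u = 19 * τ ^ 2 * Real.exp (-(2 * μ)) := by
    rw [integral_const_mul, ← intervalIntegral.integral_of_le hτ0.le, integral_id]
    ring
  -- Part 2: `[τ, ∞)`
  have hpt2 : ∀ u ∈ Ioi τ, F u ≤ τ ^ 2 * (Real.exp (-(2 : ℝ)) * Real.exp (-(s - 2 / τ) * u)) := by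
    intro u hu
    have hu' : τ ≤ u := le_of_lt hu
    have hG1 := reg_G_le_one hu'
    have htail := reg_pow_mul_exp_le (s := s) hτ0 hu' 2
    push_cast at htail
    calc F u = (layerInteraction (fun r => Real.exp (-u * r ^ 2)) 1 0 0 0 -
          layerInteraction (fun r => Real.exp (-u * r ^ 2)) 1 0 1 0) * (u ^ 2 * Real.exp (-(u * s))) := by
          simp only [hF]
          ring
      _ ≤ 1 * (u ^ 2 * Real.exp (-(u * s))) := mul_le_mul_of_nonneg_right hG1 (by positivity)
      _ ≤ _ := by rw [one_mul]; exact htail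
  have hB : IntegrableOn (fun u => τ ^ 2 * (Real.exp (-(2 : ℝ)) * Real.exp (-(s - 2 / τ) * u))) (Ioi τ) :=
    (((exp_neg_integrableOn_Ioi τ hc0).const_mul _).const_mul _)
  have h2a : ∫ u in Ioi τ, F u ≤ ∫ u in Ioi τ, τ ^ 2 * (Real.exp (-(2 : ℝ)) * Real.exp (-(s - 2 / τ) * u)) :=
    setIntegral_mono_on (hFi.mono_set (Ioi_subset_Ioi hτ0.le)) hB measurableSet_Ioi hpt2
  have e1 : Real.exp (-(2 : ℝ)) * Real.exp (-(s - 2 / τ) * τ) = Real.exp (-(τ * s)) := by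
    rw [← Real.exp_add]
    congr 1
    field_simp
    ring
  have h2b : ∫ u in Ioi τ, τ ^ 2 * (Real.exp (-(2 : ℝ)) * Real.exp (-(s - 2 / τ) * u)) =
      τ ^ 2 * Real.exp (-(τ * s)) / (s - 2 / τ) := by
    rw [integral_const_mul, integral_const_mul, integral_exp_mul_Ioi (by linarith) τ, neg_div_neg_eq,
      ← mul_div_assoc, ← mul_div_assoc, e1]
  have h2c : τ ^ 2 * Real.exp (-(τ * s)) / (s - 2 / τ) ≤ τ ^ 2 * Real.exp (-(τ * s)) / (13689 / 2500 - 2 / τ) :=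
    div_le_div_of_nonneg_left (by positivity) hc3 (by linarith)
  rw [hsplit]
  have hI1 : ∫ u in Ioc 0 τ, F u ≤ 19 * τ ^ 2 * Real.exp (-(2 * μ)) := h1a.trans h1b.le
  have hI2 : ∫ u in Ioi τ, F u ≤ τ ^ 2 * Real.exp (-(τ * s)) / (13689 / 2500 - 2 / τ) :=
    h2a.trans (h2b.le.trans h2c)
  exact add_le_add hI1 hI2

/-- `e^{-5.658} ≤ 9/2500`. [folklore] -/
theorem ljd_rho_bound : Real.exp (-(2 * (2829 / 1000 : ℝ))) ≤ 9 / 2500 := by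
  have h := reg_exp_neg_le 5 (f := 658 / 1000) (by norm_num)
  rw [show (2 * (2829 / 1000 : ℝ)) = ((5 : ℕ) : ℝ) + 658 / 1000 by norm_num]
  exact h.trans (by norm_num)

/-- **Geometric decay of the `t²`-moments along `s = (k c)²`**: for `k ≥ 3` and `c ≥ 39/50`,
`∫_0^∞ G(u) u² e^{-u (k c)²} du ≤ C_F ρ^k` with `ρ = 9/2500` and
`C_F = τ² (19 + 1/(s₃ - 2/τ))` (`μ = 2.829 k`, `2.829² ≤ 13.159 (39/50)²`, `e^{-5.658} ≤ ρ`, and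
`τ (k c)² ≥ 3 τ (39/50)² k ≥ 5.658 k`). [folklore] -/
theorem ljd_Fk_le (k : ℕ) (hk : 3 ≤ k) {c : ℝ} (hc : 39 / 50 ≤ c) :
    ∫ u in Ioi (0 : ℝ), (layerInteraction (fun r => Real.exp (-u * r ^ 2)) 1 0 0 0 -
        layerInteraction (fun r => Real.exp (-u * r ^ 2)) 1 0 1 0) * u ^ 2 * Real.exp (-(u * ((k : ℝ) * c) ^ 2)) ≤
      (87 / 20 : ℝ) ^ 2 * (19 + 1 / (13689 / 2500 - 2 / (87 / 20))) * (9 / 2500) ^ k := by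
  have hk3 : (3 : ℝ) ≤ k := by exact_mod_cast hk
  have hkc : 117 / 50 ≤ (k : ℝ) * c := by nlinarith
  have hs : 13689 / 2500 ≤ ((k : ℝ) * c) ^ 2 := by nlinarith
  have hμ : ((k : ℝ) * (2829 / 1000)) ^ 2 ≤ 13159 / 1000 * ((k : ℝ) * c) ^ 2 := by
    have hc2 : (39 / 50 : ℝ) ^ 2 ≤ c ^ 2 := pow_le_pow_left₀ (by norm_num) hc 2
    nlinarith [sq_nonneg (k : ℝ)]
  have h := ljd_F_le hs hμ
  have hρ := ljd_rho_bound
  have hρ0 : 0 ≤ Real.exp (-(2 * (2829 / 1000 : ℝ))) := (Real.exp_pos _).le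
  have hpow : Real.exp (-(2 * (2829 / 1000 : ℝ))) ^ k ≤ (9 / 2500 : ℝ) ^ k := pow_le_pow_left₀ hρ0 hρ k
  have h1 : Real.exp (-(2 * ((k : ℝ) * (2829 / 1000)))) ≤ (9 / 2500 : ℝ) ^ k := by
    rw [show -(2 * ((k : ℝ) * (2829 / 1000))) = k * (-(2 * (2829 / 1000 : ℝ))) by ring, Real.exp_nat_mul]
    exact hpow
  have h2 : Real.exp (-(87 / 20 * ((k : ℝ) * c) ^ 2)) ≤ (9 / 2500 : ℝ) ^ k := by
    have hkk : (3 : ℝ) * k ≤ (k : ℝ) ^ 2 := by nlinarith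
    have hc2 : (39 / 50 : ℝ) ^ 2 ≤ c ^ 2 := pow_le_pow_left₀ (by norm_num) hc 2
    have hle : (k : ℝ) * (2 * (2829 / 1000)) ≤ 87 / 20 * ((k : ℝ) * c) ^ 2 := by
      nlinarith [mul_le_mul_of_nonneg_left hc2 (by positivity : (0 : ℝ) ≤ 87 / 20 * (k : ℝ) ^ 2)]
    calc Real.exp (-(87 / 20 * ((k : ℝ) * c) ^ 2)) ≤ Real.exp (k * (-(2 * (2829 / 1000 : ℝ)))) :=
          Real.exp_le_exp.2 (by linarith)
      _ = Real.exp (-(2 * (2829 / 1000 : ℝ))) ^ k := Real.exp_nat_mul _ _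
      _ ≤ _ := hpow
  have hC : (0 : ℝ) ≤ (87 / 20) ^ 2 / (13689 / 2500 - 2 / (87 / 20)) := by norm_num
  calc _ ≤ 19 * (87 / 20) ^ 2 * Real.exp (-(2 * ((k : ℝ) * (2829 / 1000)))) +
        (87 / 20) ^ 2 * Real.exp (-(87 / 20 * ((k : ℝ) * c) ^ 2)) / (13689 / 2500 - 2 / (87 / 20)) := h
    _ = 19 * (87 / 20) ^ 2 * Real.exp (-(2 * ((k : ℝ) * (2829 / 1000)))) +
        (87 / 20) ^ 2 / (13689 / 2500 - 2 / (87 / 20)) * Real.exp (-(87 / 20 * ((k : ℝ) * c) ^ 2)) := by ring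
    _ ≤ 19 * (87 / 20) ^ 2 * (9 / 2500 : ℝ) ^ k + (87 / 20) ^ 2 / (13689 / 2500 - 2 / (87 / 20)) * (9 / 2500 : ℝ) ^ k :=
        add_le_add (mul_le_mul_of_nonneg_left h1 (by norm_num)) (mul_le_mul_of_nonneg_left h2 hC)
    _ = _ := by ring

/-! ## The certified size of `J₂`: `-D_a(17a/10) ≥ (1797/10⁷)/(12 a⁶)` -/

/-- **The `m = 1` one-point certificate at `s = (17/10)²`**:
`∫_0^∞ G(u) u² (u³/τ³ - 1) e^{-u (17/10)²} du ≤ -1797/10⁷` (level set `[1.54, 2.95]` of level `13`,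
`LayeredHull.reg_certificate`). [folklore] -/
theorem ljd_N4 : ∫ u in Set.Ioi (0 : ℝ), (layerInteraction (fun r => Real.exp (-u * r ^ 2)) 1 0 0 0 -
    layerInteraction (fun r => Real.exp (-u * r ^ 2)) 1 0 1 0) * (u ^ 2 * (u ^ 3 / (87 / 20) ^ 3 - 1)) *
      Real.exp (-(u * (17 / 10) ^ 2)) ≤ -(1797 / 10000000) := by
  have h := reg_certificate 1 (Or.inl rfl) (s := (17 / 10) ^ 2) (L := 13) (ta := 154 / 100) (tb := 295 / 100)
    (Cl := 3264 / 100) (El := 22603 / 10000000000) (Eu := 17709 / 5000000000)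
    (by norm_num) (by norm_num) (by norm_num) (by norm_num) (by norm_num) (by norm_num)
    reg_pi_bounds.2 (by norm_num) reg_exp_neg_twelve_thirteen.2 reg_exp_neg_tail.2
  simp only [Nat.reduceAdd] at h
  exact h.trans (by norm_num)

/-- **Certified size of the second coupling.** For `a ≥ 47/50`:
`(1797/10⁷)/(12 a⁶) ≤ -D_a(17a/10)` (`a ≥ 47/50`), `D_a(H) = barlowCoupling lennardJones a H 1`
(`w(t) ≤ t²(a⁶t³/τ³ - 1)/12` since `τ³ ≤ 120 a⁶`, then the scaled certificate `ljd_N4`). [folklore] -/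
theorem stub_ljdJ2Lower : ∀ a : ℝ, 47 / 50 ≤ a → 1797 / 10000000 / (12 * a ^ 6) ≤ -Literature.MathematicalPhysics.StatisticalMechanics.barlowCoupling Literature.MathematicalPhysics.StatisticalMechanics.lennardJones a (17 / 10 * a) 1 := by
  intro a ha
  have ha0 : 0 < a := by linarith
  have h17 : (17 / 10 * a) ≠ 0 := by positivity
  set S₂ : ℝ := (17 / 10 * a) ^ 2 with hS₂
  have hS₂pos : 0 < S₂ := by positivity
  have hg0 : ∀ t, 0 < t → 0 ≤ layerInteraction (fun r => Real.exp (-t * r ^ 2)) a 0 0 0 -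
      layerInteraction (fun r => Real.exp (-t * r ^ 2)) a 0 1 0 := fun t ht =>
    sub_nonneg.2 (reg_theta_le_theta_zero ha0.ne' 1 ht)
  have hτ : (87 / 20 : ℝ) ^ 3 ≤ 120 * a ^ 6 := by
    have : (47 / 50 : ℝ) ^ 6 ≤ a ^ 6 := pow_le_pow_left₀ (by norm_num) ha 6
    nlinarith
  have hcmp2 : ∀ t, 0 < t → lennardJonesDensity t ≤
      (1 / 12) * (t ^ 2 * (a ^ 6 * t ^ 3 / (87 / 20) ^ 3 - 1)) := fun t ht => by
    simp only [lennardJonesDensity]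
    have h5 := mul_le_mul_of_nonneg_left hτ (by positivity : (0 : ℝ) ≤ t ^ 5)
    have e : (1 : ℝ) / 12 * (t ^ 2 * (a ^ 6 * t ^ 3 / (87 / 20) ^ 3 - 1)) =
        (t ^ 5 * (120 * a ^ 6)) / (1440 * (87 / 20) ^ 3) - t ^ 2 / 12 := by ring
    rw [e, div_eq_mul_inv (t ^ 5 * (120 * a ^ 6)), show t ^ 5 / 1440 =
      t ^ 5 * (87 / 20 : ℝ) ^ 3 * (1440 * (87 / 20 : ℝ) ^ 3)⁻¹ by field_simp]
    have : 0 < (1440 * (87 / 20 : ℝ) ^ 3)⁻¹ := by positivity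
    nlinarith
  have hint : IntegrableOn (fun t => (layerInteraction (fun r => Real.exp (-t * r ^ 2)) a 0 0 0 -
      layerInteraction (fun r => Real.exp (-t * r ^ 2)) a 0 1 0) * lennardJonesDensity t * Real.exp (-(t * S₂)))
      (Ioi 0) := by
    refine IntegrableOn.congr_fun (reg_integrableOn_diff_poly ha0.ne' hS₂pos (-(1 / 12)) 0 (1 / 1440) 0)
      (fun t _ => ?_) measurableSet_Ioi
    simp only [lennardJonesDensity]
    ring
  have hA := reg_scaled_certificate ha0 2 (17 / 10) (-(1797 / 10000000)) ljd_N4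
  rw [← hS₂] at hA
  have hD : barlowCoupling lennardJones a (17 / 10 * a) 1 ≤ (1 / 12) * (-(1797 / 10000000) / a ^ (2 * 2 + 2)) := by
    rw [reg_barlowCoupling_eq_integral ha0 h17, ← hS₂]
    calc _ ≤ ∫ t in Ioi (0 : ℝ), (layerInteraction (fun r => Real.exp (-t * r ^ 2)) a 0 0 0 -
          layerInteraction (fun r => Real.exp (-t * r ^ 2)) a 0 1 0) *
          ((1 / 12) * (t ^ 2 * (a ^ 6 * t ^ 3 / (87 / 20) ^ 3 - 1))) * Real.exp (-(t * S₂)) :=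
          setIntegral_mono_on hint (IntegrableOn.congr_fun (reg_integrableOn_diff_poly ha0.ne'
            hS₂pos (-(1 / 12)) 0 (a ^ 6 / (12 * (87 / 20) ^ 3)) 0) (fun t _ => by ring) measurableSet_Ioi)
            measurableSet_Ioi fun t (ht : 0 < t) => mul_le_mul_of_nonneg_right
              (mul_le_mul_of_nonneg_left (hcmp2 t ht) (hg0 t ht)) (Real.exp_pos _).le
      _ = (1 / 12) * ∫ t in Ioi (0 : ℝ), (layerInteraction (fun r => Real.exp (-t * r ^ 2)) a 0 0 0 -
          layerInteraction (fun r => Real.exp (-t * r ^ 2)) a 0 1 0) *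
          (t ^ 2 * (a ^ 6 * t ^ 3 / (87 / 20) ^ 3 - 1)) * Real.exp (-(t * S₂)) := by
          rw [← integral_const_mul]
          exact setIntegral_congr_fun measurableSet_Ioi fun t _ => by ring
      _ ≤ _ := mul_le_mul_of_nonneg_left hA (by norm_num)
  have ha6 : 0 < a ^ 6 := by positivity
  have e : (1 : ℝ) / 12 * (-(1797 / 10000000) / a ^ (2 * 2 + 2)) = -(1797 / 10000000 / (12 * a ^ 6)) := by
    norm_num
    field_simp
  linarith [hD, e.le, e.ge]

end Summit.AtomisticToContinuum.Crystallization.Theorems.PricedHcpWindowsLjDomination
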